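import Literature.MathematicalPhysics.QuantumLattice.Imbrie2016.WeylWindow

/-!
# Imbrie (2016), Assumption LLA vs. the Dietlein–Elgart level-spacing engine: the band-edge window of the block
Hamiltonian (1.1) contains at most ONE level (audit-cell lemma, kernel-checked)

CITATION HEADER (lean-in-tree rule 2026-08-18). J. Z. Imbrie, *On many-body localization for quantum spin chains*,
J. Stat. Phys. **163** (2016) 998–1048, doi 10.1007/s10955-016-1508-x, arXiv:1403.7837 [ImbrieJSP2016]: eq. (1.1) (block
Hamiltonian H = Σ h_i S^z_i + Σ_b J_b S^z_{b−1} S^z_b + γ Σ Γ_i S^x_i, + boundary conditions), eq. (1.3) = (5.2) (Assumption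
LLA(ν, C): P(min_{α≠β} |E_α − E_β| < δ) ≤ δ^ν Cⁿ — all 2ⁿ − 1 consecutive spacings). A. Dietlein, A. Elgart, *Level spacing and
Poisson statistics for continuum random Schrödinger operators*, J. Eur. Math. Soc. **23** (2021), doi 10.4171/jems/1033,
arXiv:1712.03925 [DietleinElgart2020]: Lemma 4.2 (an isolated cluster of eigenvalues that is tight on a whole cube of coupling
configurations has central energy ≥ E_{L,ℓ,n,r}; proof by Neumann decoupling of the kinetic term, whose local pieces have a
ONE-dimensional kernel, dropping the potential V_ω ≥ 0) and §2.2 ("the method below is limited to E ≤ λ₂^{(N)}/2 … the spectral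
projection of this operator onto [0, λ₂^{(N)}) is rank one which we use explicitly in our reduction scheme"). S. Herschenfeld,
P. D. Hislop, *Local eigenvalue statistics for higher-rank Anderson models after Dietlein–Elgart*, Rev. Math. Phys. **35** (2023),
doi 10.1142/s0129055x23500174, arXiv:2208.03598 [HerschenfeldHislop2023]: §1.4 ("One of the current limitations of the method comes
primarily from the lower bound estimate based on the first nonzero Neumann eigenvalue").
WHAT IS PROVED (lemmas of the audit cell `pub-imbrie`, REPAIR-CENSUS V17 / ENGINE-DE.md of unit b2b-imbrie-2-g9 — NOT statements of
any of the three papers). Write F := Σ_i |h_i| + Σ_b |J_b| (spelled out in the statements; the file is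
definition-free) and t := |γ| Σ_i |Γ_i|, so that E_floor := −F − t is a lower bound of H (the Dietlein–Elgart "bottom of the kinetic-plus-nonnegative-potential" after the dictionary h_i S^z_i =
|h_i|(2Π_i − 1), γΓ_i S^x_i = −|γΓ_i|(1 − S̃^x_i) + |γΓ_i| of ENGINE-DE.md §1):
  * `abs_szZ`, `diagFloor_le_diagEnergy`: every configuration energy is ≥ −F;
  * `card_diagEnergy_lt_floor_add_le_one`: if m ≤ min_i |h_i| then AT MOST ONE configuration has energy < −F + 2m (a
    configuration in that window satisfies every field term with its minimal sign, which determines it; the bonds play no role);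
  * `floor_le_eigs`: every eigenvalue of H(γ) is ≥ E_floor = −F − t (Weyl counting vs. the diagonal H(0));
  * `card_eigs_lt_floor_add_le_one` (**the band-edge window holds at most one level**): if m ≤ min_i |h_i| then
    #{α : E_α(H(γ)) < E_floor + 2m} ≤ 1 (`…_window_le_one`: the same for any width W ≤ 2m).
CONSEQUENCE (prose, ENGINE-DE.md §3): the transferred Dietlein–Elgart Lemma 4.2 only constrains clusters with central energy in
[E_floor, E_floor + W) with W < 2|γ| max_i |Γ_i| ≤ 2|γ| (kinetic repulsion cannot certify more than the kinetic scale); by the last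
theorem that window contains at most one level unless min_i |h_i| < |γ| (probability ≤ 2ρ₀ n |γ|), so the hypothesis class of the
transferred lemma is empty in the bulk and the engine says nothing about the 2ⁿ − 2 bulk spacings that LLA (1.3) quantifies.
STATUS: unconditional deterministic theorems about the model (1.1); they neither prove nor disprove LLA — LLA for γ > 0 remains
the unproved hypothesis of [ImbrieJSP2016] Thm 1.1 (cell verdict: open). Unit b2b-imbrie-2-g9 (gen 9 of the SURVIVAL/DEBATE seat).
-/

noncomputable section
open _root_.MeasureTheory Matrix Finset Filter Topology
open scoped InnerProductSpace ENNReal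

namespace Literature.MathematicalPhysics.QuantumLattice.Imbrie2016

variable {n : ℕ}

/-! ## The floor of the configuration energies -/

/-- |S^z| = 1 at every site of ℤ (inside the box ±1, outside the + boundary condition). [cite: ImbrieJSP2016, eq. (1.1)] -/
theorem abs_szZ (σ : Cfg n) (k : ℤ) : |szZ σ k| = 1 := by
  unfold szZ
  split_ifs <;> simp

/-- a field term is ≥ −|h_i|. [cite: ImbrieJSP2016, eq. (1.1)] -/
theorem neg_abs_le_field (p : Params n) (σ : Cfg n) (i : Fin n) : -|p.h i| ≤ p.h i * szZ σ i := by
  have h1 : |p.h i * szZ σ i| = |p.h i| := by rw [abs_mul, abs_szZ, mul_one]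
  have h2 := neg_abs_le (p.h i * szZ σ i)
  rwa [h1] at h2

/-- a bond term is ≥ −|J_b|. [cite: ImbrieJSP2016, eq. (1.1)] -/
theorem neg_abs_le_bond (p : Params n) (σ : Cfg n) (b : Fin (n + 1)) :
    -|p.J b| ≤ p.J b * szZ σ ((b : ℤ) - 1) * szZ σ b := by
  have h1 : |p.J b * szZ σ ((b : ℤ) - 1) * szZ σ b| = |p.J b| := by
    rw [abs_mul, abs_mul, abs_szZ, abs_szZ, mul_one, mul_one]
  have h2 := neg_abs_le (p.J b * szZ σ ((b : ℤ) - 1) * szZ σ b)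
  rwa [h1] at h2

/-- every configuration energy is ≥ the floor −(Σ|h_i| + Σ|J_b|). [cite: ImbrieJSP2016, eq. (1.1)] -/
theorem diagFloor_le_diagEnergy (p : Params n) (σ : Cfg n) :
    -((∑ i, |p.h i|) + ∑ b, |p.J b|) ≤ diagEnergy p σ := by
  unfold diagEnergy
  have h1 : ∑ i : Fin n, -|p.h i| ≤ ∑ i : Fin n, p.h i * szZ σ i :=
    Finset.sum_le_sum fun i _ => neg_abs_le_field p σ i
  have h2 : ∑ b : Fin (n + 1), -|p.J b| ≤ ∑ b : Fin (n + 1), p.J b * szZ σ ((b : ℤ) - 1) * szZ σ b :=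
    Finset.sum_le_sum fun b _ => neg_abs_le_bond p σ b
  rw [Finset.sum_neg_distrib] at h1 h2
  linarith

/-- a field term that is NOT at its minimal sign equals +|h_i|: if σ_i ≠ [h_i < 0] then h_i S^z_i(σ) = |h_i|.
[cite: ImbrieJSP2016, eq. (1.1)] -/
theorem field_eq_abs_of_ne (p : Params n) (σ : Cfg n) (i : Fin n) (hne : σ i ≠ decide (p.h i < 0)) :
    p.h i * szZ σ i = |p.h i| := by
  rw [szZ_site]
  cases hσ : σ i
  · rw [hσ] at hne
    have hlt : p.h i < 0 := by
      by_contra hge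
      exact hne (by simp [hge])
    rw [abs_of_neg hlt]; simp
  · rw [hσ] at hne
    have hge : 0 ≤ p.h i := by
      by_contra hlt
      push Not at hlt
      exact hne (by simp [hlt])
    rw [abs_of_nonneg hge]; simp

/-- a configuration that differs from the field-minimising one at some site has energy ≥ floor + 2|h_i|.
[cite: ImbrieJSP2016, eq. (1.1)] -/
theorem diagFloor_add_le_diagEnergy_of_ne (p : Params n) (σ : Cfg n) (i : Fin n)
    (hne : σ i ≠ decide (p.h i < 0)) : -((∑ i, |p.h i|) + ∑ b, |p.J b|) + 2 * |p.h i| ≤ diagEnergy p σ := by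
  unfold diagEnergy
  -- field part: Σ_i' (h s + |h|) ≥ 2|h_i|, all terms nonnegative
  have hnonneg : ∀ i' ∈ (univ : Finset (Fin n)), 0 ≤ p.h i' * szZ σ i' + |p.h i'| := by
    intro i' _
    have := neg_abs_le_field p σ i'
    linarith
  have hsingle : p.h i * szZ σ i + |p.h i| ≤ ∑ i' : Fin n, (p.h i' * szZ σ i' + |p.h i'|) :=
    Finset.single_le_sum hnonneg (Finset.mem_univ i)
  rw [field_eq_abs_of_ne p σ i hne, Finset.sum_add_distrib] at hsingle
  have h2 : ∑ b : Fin (n + 1), -|p.J b| ≤ ∑ b : Fin (n + 1), p.J b * szZ σ ((b : ℤ) - 1) * szZ σ b :=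
    Finset.sum_le_sum fun b _ => neg_abs_le_bond p σ b
  rw [Finset.sum_neg_distrib] at h2
  linarith

/-- **At most one configuration in the window [floor, floor + 2m)**, m ≤ min_i |h_i| (no sign condition on m is needed; for
m ≤ 0 the window is empty): a configuration there has every field term at its minimal sign, which determines it.
[cite: ImbrieJSP2016, eq. (1.1)] -/
theorem card_diagEnergy_lt_floor_add_le_one (p : Params n) {m : ℝ} (hh : ∀ i, m ≤ |p.h i|) :
    #{σ : Cfg n | diagEnergy p σ < -((∑ i, |p.h i|) + ∑ b, |p.J b|) + 2 * m} ≤ 1 := by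
  refine Finset.card_le_one.mpr fun σ hσ τ hτ => ?_
  simp only [Finset.mem_filter, Finset.mem_univ, true_and] at hσ hτ
  -- both equal the field-minimising configuration
  have key : ∀ ρ : Cfg n, diagEnergy p ρ < -((∑ i, |p.h i|) + ∑ b, |p.J b|) + 2 * m →
      ρ = fun i => decide (p.h i < 0) := by
    intro ρ hρ
    funext i
    by_contra hne
    have h1 := diagFloor_add_le_diagEnergy_of_ne p ρ i hne
    have h2 := hh i
    linarith
  rw [key σ hσ, key τ hτ]

/-! ## Weyl lift to the eigenvalues of H(γ) -/

/-- the diagonal form is below the full form plus t‖x‖², t = |γ| Σ|Γ_i| (Schur test on the transverse part).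
[cite: ImbrieJSP2016, eq. (1.1)] -/
theorem re_inner_H_zero_le (γ : ℝ) (p : Params n) (x : EuclideanSpace ℝ (Cfg n)) :
    RCLike.re ⟪x, toEuclideanLin (H 0 p) x⟫_ℝ ≤
      RCLike.re ⟪x, toEuclideanLin (H γ p) x⟫_ℝ + (|γ| * ∑ i, |p.Γ i|) * ‖x‖ ^ 2 := by
  have hHB : H γ p = H 0 p + Matrix.of (offDiag γ p) := by rw [H_zero]; rfl
  have hform : RCLike.re ⟪x, toEuclideanLin (H γ p) x⟫_ℝ = RCLike.re ⟪x, toEuclideanLin (H 0 p) x⟫_ℝ +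
      RCLike.re ⟪x, toEuclideanLin (Matrix.of (offDiag γ p)) x⟫_ℝ := by
    rw [hHB, map_add, LinearMap.add_apply, inner_add_right, map_add]
  have h1 := (abs_le.mp (abs_re_inner_offDiag_le γ p x)).1
  rw [hform]; linarith

/-- Weyl counting: #{α : E_α(H(γ)) < a} ≤ #{σ : E_σ(H(0)) < a + |γ| Σ|Γ_i|}. [cite: ImbrieJSP2016, eq. (1.1)] -/
theorem card_eigs_lt_le_card_diagEnergy_lt (γ : ℝ) (p : Params n) (a : ℝ) :
    #{α : Cfg n | eigs γ p α < a} ≤ #{σ : Cfg n | diagEnergy p σ < a + |γ| * ∑ i, |p.Γ i|} := by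
  have hW := card_eigenvalues_lt_le_card_of_forms (H_isHermitian γ p) (H_isHermitian 0 p)
    (re_inner_H_zero_le γ p) a
  have hC := card_filter_eigs_zero_eq p (fun v => v < a + |γ| * ∑ i, |p.Γ i|)
  rw [← hC]
  exact hW

/-- **every eigenvalue of H(γ) is ≥ E_floor = −(Σ|h_i| + Σ|J_b|) − |γ| Σ|Γ_i|.** [cite: ImbrieJSP2016, eq. (1.1)] -/
theorem floor_le_eigs (γ : ℝ) (p : Params n) (α : Cfg n) :
    -((∑ i, |p.h i|) + ∑ b, |p.J b|) - |γ| * ∑ i, |p.Γ i| ≤ eigs γ p α := by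
  by_contra hlt
  push Not at hlt
  have h1 := card_eigs_lt_le_card_diagEnergy_lt γ p (-((∑ i, |p.h i|) + ∑ b, |p.J b|) - |γ| * ∑ i, |p.Γ i|)
  rw [sub_add_cancel] at h1
  have h0 : #{σ : Cfg n | diagEnergy p σ < -((∑ i, |p.h i|) + ∑ b, |p.J b|)} = 0 := by
    refine Finset.card_eq_zero.mpr (Finset.filter_eq_empty_iff.mpr fun σ _ => ?_)
    exact not_lt.mpr (diagFloor_le_diagEnergy p σ)
  have hpos : 0 < #{α : Cfg n | eigs γ p α < -((∑ i, |p.h i|) + ∑ b, |p.J b|) - |γ| * ∑ i, |p.Γ i|} :=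
    Finset.card_pos.mpr ⟨α, by simpa only [Finset.mem_filter, Finset.mem_univ, true_and] using hlt⟩
  omega

/-- **The band-edge window holds at most one level.** If m ≤ min_i |h_i| then at most one eigenvalue of H(γ) lies below
E_floor + 2m, E_floor = −(Σ|h_i| + Σ|J_b|) − |γ| Σ|Γ_i|. With the Dietlein–Elgart window width W < 2|γ| ≤ 2m this empties the
hypothesis class of the transferred [DietleinElgart2020] Lemma 4.2 in the bulk (ENGINE-DE.md §3). [cite: ImbrieJSP2016, eq. (1.1)] -/
theorem card_eigs_lt_floor_add_le_one (γ : ℝ) (p : Params n) {m : ℝ} (hh : ∀ i, m ≤ |p.h i|) :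
    #{α : Cfg n | eigs γ p α < -((∑ i, |p.h i|) + ∑ b, |p.J b|) - |γ| * ∑ i, |p.Γ i| + 2 * m} ≤ 1 := by
  have h1 := card_eigs_lt_le_card_diagEnergy_lt γ p (-((∑ i, |p.h i|) + ∑ b, |p.J b|) - |γ| * ∑ i, |p.Γ i| + 2 * m)
  have e : -((∑ i, |p.h i|) + ∑ b, |p.J b|) - |γ| * ∑ i, |p.Γ i| + 2 * m + |γ| * ∑ i, |p.Γ i| =
      -((∑ i, |p.h i|) + ∑ b, |p.J b|) + 2 * m := by ring
  rw [e] at h1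
  exact h1.trans (card_diagEnergy_lt_floor_add_le_one p hh)

/-- packaged form: for every window width W ≤ 2 min_i |h_i| (in particular the kinetic-scale widths W ≤ 2|γ| ≤ 2 min_i|h_i| of a
Dietlein–Elgart type argument), [E_floor, E_floor + W) contains at most one eigenvalue of H(γ). [cite: ImbrieJSP2016, eq. (1.1)] -/
theorem card_eigs_lt_floor_add_window_le_one (γ : ℝ) (p : Params n) {m W : ℝ} (hh : ∀ i, m ≤ |p.h i|)
    (hW : W ≤ 2 * m) :
    #{α : Cfg n | eigs γ p α < -((∑ i, |p.h i|) + ∑ b, |p.J b|) - |γ| * ∑ i, |p.Γ i| + W} ≤ 1 := by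
  refine le_trans (Finset.card_le_card fun α hα => ?_) (card_eigs_lt_floor_add_le_one γ p hh)
  simp only [Finset.mem_filter, Finset.mem_univ, true_and] at hα ⊢
  linarith

end Literature.MathematicalPhysics.QuantumLattice.Imbrie2016
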